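import Summits.HodgeConjecture.HodgeConjecture.Cruxes.BlochSeedDiscOne.SeedCheckerSplitBlockCFree
import Summits.HodgeConjecture.HodgeConjecture.Cruxes.BlochSeedDiscOne.StaticAlongTW
import Summits.HodgeConjecture.HodgeConjecture.Cruxes.BlochSeedDiscOne.KunnethNoInterferenceDatumLaw
import Literature.AlgebraicGeometry.HodgeTheory.KodairaSpencerObstructionClass
import HarnessLib

/-!
# `StaticAlongTW` — layer (B): the law IN THE v42.1 `SplitBlock.DatumLaw` SHAPE, and the typed signature of the α1 bridge stub
# (director-hodge R19.867 (L2′); hsemireg-semihom-1 g68; crux item `stmt-HodgeConjecture-18881`)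

Token: `line stmt-HodgeConjecture-18881 Cruxes/BlochSeedDiscOne/Lines/birth.lean 814a6a70c14e831a stub_rung_pad4_seedAt` — UNTOUCHED; no `Lines/*`
is imported or edited; nothing here is proved toward HC ∕ HC_CM ∕ HC_AV ∕ №4 ∕ 26512 ∕ 18881 ∕ 30548 ∕ H2.  No `sorry` ∕ `axiom` ∕ `instance` ∕ `notation`.

* `TangentFamilySelector := ∀ E₀ ψ₀, WeilTangentFamily E₀ ψ₀` — the D-L2a datum for every anchor, a PARAMETER (intended value: the Weil
  tangent family of `(S⁴, λ, pad4Action E₀ ψ₀)`, definition request D-L2a; nothing asserts one exists or is chosen).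
* **`StaticAlongTW W : SplitBlock.DatumLaw`** `:= fun E₀ ψ₀ δ₀ => StaticAlongTWSheaf (W E₀ ψ₀) δ₀.S.X₃ δ₀.isVectorBundle₃` — R19.867 (i): the law
  lives on the SHEAF `𝓔 := δ₀.S.X₃` over `X := (pad4Anchor E₀).X`; it is «∀ κ ∈ T_W(E₀, ψ₀), κ ⌟ At(𝓔) = 0 ∈ Ext²(𝓔, 𝓔)» with the tree's REAL
  Atiyah class (layer (A) `obstructionMap`, Huybrechts–Thomas Cor. 3.4); it is NOT `RuleD δ₀.Dsh.shadow` nor any row.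
* the `Λ`-slots of record (v42.1 `Rung2b₀Lci` docstring, KNI adapter): (8♮) `Rung2b₀Lci (StaticAlongTW W) RowAlpha3.phiAll 0`,
  (8σ) `Rung2b₀Lci (lawAnd (StaticAlongTW W) kniLaw) sigmaH 0` — typed below as `example`s; the budget conjunct of (8σ) is kernel
  (`budgetClause_sigmaH_of_lawAnd_kniLaw`), independent of `W`.
* **the α1 bridge, typed three ways** (TYPED SIGNATURES of the design-level bridge R19.867 (iii) «static along `T_W` ⟹ RULE D of the shadow», pen
  THEOREM P ∕ LEMMA S of hsem-3 memo-211, g65 §6 P2 + §1 D3): `Alpha1OfStatic W` (literal (iii): `∀ CM anchors δ₀, StaticAlongTW W δ₀ → δ₀.Dsh.Positive →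
  ScopeRows 14 δ₀.Dsh.shadow → LeggedFloor.RuleD δ₀.Dsh.shadow`), its F6 form `Alpha1Row W := Rung2b₀Under (StaticAlongTW W) 14 RuleD` (reads `Passes`,
  memo-212 R0), and the RECOMMENDED register form **`Alpha1RowTied W := Rung2b₀Under (lawStaticTied W) 14 RuleD`** with `lawStaticTied W := StaticAlongTW W ∧
  δ₀.Realisable` (the realisation tie (R3), forced by F8: C-free letters are the sheaf's only under the tie); implications `Alpha1OfStatic → Alpha1Row →
  Alpha1RowTied → Rung2b₀Under Λ' 14 RuleD` for every `Λ' ≤ lawStaticTied W` — in particular cruxplan g1's `lawSigma (StaticAlongTW W) = StaticAlongTW W ∧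
  Realisable ∧ KNI` (`alpha1_of_le_lawStaticTied`).  All are `def … : Prop`, NOT theorems and not sorried here: cruxplan-18881-splitblock registers
  `theorem stub_alpha1 : Rung2b₀Under (lawSigma (StaticAlongTW W)) 14 LeggedFloor.RuleD := …` (its announced g2 shape) in ITS skeleton (one writer).  CAVEAT typed
  into the docstrings: over an ARBITRARY selector `W` the statements are false-prone (a 16-plane unrelated to the Weil family detects nothing); they are the
  pen theorem only at the INTENDED instance (D-L2a), whose letter dictionary «`(g,j)`-block of `ob_κ(L_c) ≠ 0` for some `κ ∈ T_W` ⟺ `LeggedFloor.Detects c g j`»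
  is definition request D-L2c (memo §3).

* **CARRIER NOTE (director R19.883 (ii), «cite, don't restate»).**  The Literature decl `Literature.AlgebraicGeometry.HodgeTheory.kodairaSpencerObstruction hΩ hE κ`
  (`HodgeTheory/KodairaSpencerObstructionClass.lean`, p829104, landed the same hour) is the CANONICAL home of `ob_κ(E) = (id_E ⊗ κ) ∘ At(E)`, on the model
  «torsion-safe `atiyahClass'` · `𝓗om(𝒯,E) ≅ E ⊗ Ω¹` · `(E ⊗ –).mapExt κ` · right unitor»; layer (A)'s `obstructionMap hE κ` is the same class on the model
  «`atiyahClass` · `𝓗om(E^∨, –).mapExt κ` · biduality⁻¹».  The one-lemma bridge is TYPED below as the Prop `ObstructionCarrierBridge hΩ hE := ∀ κ, obstructionMap hE κ =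
  kodairaSpencerObstruction hΩ hE κ` — NOT proved here (not cheap: it needs (1) a comparison of the two jet sequences behind `atiyahClass` ∕ `atiyahClass'`, absent from
  the tree, (2) naturality of `Modules.tensorSheafHomDualNatIso` against `Ext.mapExactFunctor`, (3) biduality⁻¹ ↔ unitor) — flagged for lit-hodge-lemmaU-1 ∕ a typer; the
  transport lemmas `unobstructedAlong_iff_lit` ∕ `staticAlongTW_iff_lit` let every consumer switch to the Literature carrier the moment the bridge is proved, so the two
  carriers cannot drift silently.

HONESTY (R19.867 (v)): laws are HYPOTHESES on a datum; `Alpha1OfStatic` ∕ `Alpha1Row` ∕ `Alpha1RowTied` are statements to be PROVED (stubs), typed ≠ proved; no datum,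
no tangent family and no instance is constructed anywhere in layers (A)(B).
-/

noncomputable section

set_option linter.dupNamespace false
set_option autoImplicit false

open CategoryTheory AlgebraicGeometry
open Literature.AlgebraicGeometry Literature.AlgebraicGeometry.Motives

namespace Summit.HodgeConjecture.HodgeConjecture.Cruxes.BlochSeedDiscOne.StaticAlongTW

open Summit.HodgeConjecture.HodgeConjecture.Cruxes.BlochSeedDiscOne.Anchor
open Summit.HodgeConjecture.HodgeConjecture.Cruxes.BlochSeedDiscOne.SeedChecker
open Summit.HodgeConjecture.HodgeConjecture.Cruxes.BlochSeedDiscOne.SeedChecker.SplitBlock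
open Summit.HodgeConjecture.HodgeConjecture.Cruxes.BlochSeedDiscOne.KunnethNoInterference
open Summit.HodgeConjecture.HodgeConjecture.Cruxes.BlochSeedDiscOne.SigmaH

/-- the D-L2a datum on every anchor: a Weil tangent family `T_W(E₀, ψ₀) ≤ T¹(S⁴/ℂ)` for each `(E₀, ψ₀)` — a PARAMETER of the law (intended value:
definition request D-L2a; no choice is made here). -/
abbrev TangentFamilySelector : Type 1 := ∀ (E₀ : AbelianVariety ℂ) (ψ₀ : E₀ ⟶ E₀), WeilTangentFamily E₀ ψ₀

variable (W : TangentFamilySelector)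

/-- **`StaticAlongTW W : SplitBlock.DatumLaw` — THE NAMED LAW of ROW α1 on line #2 (R19.858 (b), R19.867 (L2′))**: the cokernel bundle `𝓔 = δ₀.S.X₃`
of the C-free split block is first-order unobstructed along the `ψ₀`-Weil tangent family, `∀ κ ∈ T_W(E₀, ψ₀), (id_𝓔 ⊗ κ) ∘ At(𝓔) = 0 ∈ Ext²(𝓔, 𝓔)`.
A HYPOTHESIS per datum; C-free (no Chern character theory is touched). -/
def StaticAlongTW : DatumLaw := fun E₀ ψ₀ δ₀ => StaticAlongTWSheaf (W E₀ ψ₀) δ₀.S.X₃ δ₀.isVectorBundle₃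

variable {W} {E₀ : AbelianVariety ℂ} {ψ₀ : E₀ ⟶ E₀}

theorem staticAlongTW_iff (δ₀ : SplitBlockDatum₀ E₀ ψ₀) :
    StaticAlongTW W E₀ ψ₀ δ₀ ↔
      ∀ κ ∈ (W E₀ ψ₀).carrier, obstructionMap (Modules.isFiniteLocallyFree_of_isVectorBundle δ₀.isVectorBundle₃) κ = 0 :=
  Iff.rfl

/-- the law is discharged on any datum whose cokernel has `Ext²(𝓔, 𝓔)` subsingleton (e.g. `= 0`). -/
theorem staticAlongTW_of_subsingleton (δ₀ : SplitBlockDatum₀ E₀ ψ₀) [Subsingleton (Abelian.Ext δ₀.S.X₃ δ₀.S.X₃ 2)] :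
    StaticAlongTW W E₀ ψ₀ δ₀ :=
  staticAlongTWSheaf_of_subsingleton _ _ _

variable (W)

/-! ## The `Λ`-slots of record (typing only) -/

/-- (8♮): `Λ := StaticAlongTW W`, budget functional `RowAlpha3.phiAll`, rider `0`. -/
example : Prop := Rung2b₀Lci (StaticAlongTW W) RowAlpha3.phiAll 0

/-- (8σ): `Λ := lawAnd (StaticAlongTW W) kniLaw`, budget functional `sigmaH`, rider `0`. -/
example : Prop := Rung2b₀Lci (lawAnd (StaticAlongTW W) kniLaw) sigmaH 0

/-- the budget conjunct of (8σ) is kernel under `Λ := lawAnd (StaticAlongTW W) kniLaw`, for every selector `W` (KNI adapter). -/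
example (δ₀ : SplitBlockDatum₀ E₀ ψ₀) (hΛ : lawAnd (StaticAlongTW W) kniLaw E₀ ψ₀ δ₀) (h8 : extBudgetLaw 0 E₀ ψ₀ δ₀) :
    RuleDPlate.BudgetClause sigmaH 0 δ₀.Dsh.shadow :=
  budgetClause_sigmaH_of_lawAnd_kniLaw δ₀ hΛ h8

/-- a 2b₀ under the left law alone serves the conjunction (monotonicity of `Rung2b₀Under` in `Λ`, KNI adapter). -/
example (Rows : DepthBoundA4.Design → Prop) (h : Rung2b₀Under (StaticAlongTW W) 14 Rows) :
    Rung2b₀Under (lawAnd (StaticAlongTW W) kniLaw) 14 Rows :=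
  rung2b₀Under_lawAnd_of_left h

/-! ## The α1 bridge: typed signatures for `stub_alpha1` (to be REGISTERED and PROVED by cruxplan-18881-splitblock, not here)

Three typings, strongest first; the RECOMMENDED register form is the TIED one (F8 ∕ hsem-3 memo-212 (f6): C-free letters are untied to the
sheaf unless `δ₀.Realisable`, so a letter-reading row such as RULE D can only follow from a SHEAF-level law under the realisation tie). -/

/-- **`Alpha1OfStatic W` — the design-level bridge of R19.867 (iii), typed LITERALLY** (no `Passes`, no tie): on every CM anchor, every C-free
split-block datum whose cokernel is static along `T_W`, with positive shell and in-scope shadow (height `14`), has a shadow satisfying RULE D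
(`LeggedFloor.RuleD`, both sides).  Pen source: THEOREM P ∕ LEMMA S (hsem-3 memo-211; g65 §6 P2, §1 D3): the `(g,j)`-blocks of `ob_κ(coker φ)`,
`κ ∈ T_W`, read on the letter bundles through Atiyah-class naturality, vanish only if every detecting block is SUPPLIED.  CAVEATS: (1) the pen
theorem is about the INTENDED selector (D-L2a) with the letter dictionary (D-L2c); over an arbitrary `W` the statement is false-prone; (2) WITHOUT the
realisation tie the letters of `δ₀.K` are not the sheaf's (F8) — this literal form is the STRONGEST and the most exposed; prefer `Alpha1RowTied`.
A `Prop`; nothing asserts it. -/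
def Alpha1OfStatic : Prop :=
  ∀ (E₀ : AbelianVariety ℂ) (ψ₀ : E₀ ⟶ E₀), E₀.dim = 1 → ψ₀ ≫ ψ₀ = -(1 • 𝟙 E₀) →
    ∀ δ₀ : SplitBlockDatum₀ E₀ ψ₀, StaticAlongTW W E₀ ψ₀ δ₀ → δ₀.Dsh.Positive → ScopeRows 14 δ₀.Dsh.shadow → LeggedFloor.RuleD δ₀.Dsh.shadow

/-- the literal bridge in the F6 shape of record (`Rung2b₀Under`, `δ₀.Passes` read as an extra antecedent, memo-212 R0): ROW α1 under the bare law. -/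
def Alpha1Row : Prop := Rung2b₀Under (StaticAlongTW W) 14 LeggedFloor.RuleD

theorem alpha1Row_of_alpha1OfStatic (h : Alpha1OfStatic W) : Alpha1Row W :=
  fun E₀ ψ₀ hE hψ δ₀ hΛ hpos _ hscope => h E₀ ψ₀ hE hψ δ₀ hΛ hpos hscope

/-- **the TIED law `StaticAlongTW W ∧ δ₀.Realisable`** ((R3) `SplitBlockDatum₀.Realisable`; its non-vacuity names item 19780 via `Realisable.nonempty`):
the sheaf-level law together with the realisation tie that makes the shadow's letters the sheaf's letters. -/
def lawStaticTied : DatumLaw := fun E₀ ψ₀ δ₀ => StaticAlongTW W E₀ ψ₀ δ₀ ∧ δ₀.Realisable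

theorem lawStaticTied_le : ∀ (E₀ : AbelianVariety ℂ) (ψ₀ : E₀ ⟶ E₀) (δ₀ : SplitBlockDatum₀ E₀ ψ₀),
    lawStaticTied W E₀ ψ₀ δ₀ → StaticAlongTW W E₀ ψ₀ δ₀ :=
  fun _ _ _ h => h.1

/-- **`Alpha1RowTied W` — RECOMMENDED register form of `stub_alpha1`**: ROW α1 (RULE D of the shadow) under «CM anchor → `StaticAlongTW W ∧ Realisable` →
`Positive` → `Passes` → `ScopeRows 14`», i.e. `Rung2b₀Under (lawStaticTied W) 14 LeggedFloor.RuleD`.  cruxplan g1's law of record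
`lawSigma (StaticAlongTW W) = StaticAlongTW W ∧ Realisable ∧ KNI` implies `lawStaticTied W`, so this form serves g1's slot by `alpha1_of_le_lawStaticTied`.
Still a `Prop` to be PROVED (pen THEOREM P ∕ LEMMA S at the intended selector D-L2a + dictionary D-L2c); nothing asserts it. -/
def Alpha1RowTied : Prop := Rung2b₀Under (lawStaticTied W) 14 LeggedFloor.RuleD

theorem alpha1RowTied_iff :
    Alpha1RowTied W ↔
      ∀ (E₀ : AbelianVariety ℂ) (ψ₀ : E₀ ⟶ E₀), E₀.dim = 1 → ψ₀ ≫ ψ₀ = -(1 • 𝟙 E₀) →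
        ∀ δ₀ : SplitBlockDatum₀ E₀ ψ₀, StaticAlongTW W E₀ ψ₀ δ₀ ∧ δ₀.Realisable → δ₀.Dsh.Positive → δ₀.Passes →
          ScopeRows 14 δ₀.Dsh.shadow → LeggedFloor.RuleD δ₀.Dsh.shadow :=
  Iff.rfl

/-- the bare-law row implies the tied row (`rung2b₀Under_antitone`). -/
theorem alpha1RowTied_of_alpha1Row (h : Alpha1Row W) : Alpha1RowTied W :=
  rung2b₀Under_antitone (lawStaticTied_le W) h

/-- **serving any law of record below the tied law** — e.g. cruxplan g1's `lawSigma (StaticAlongTW W)` (`= StaticAlongTW W ∧ Realisable ∧ KNI`):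
`(∀ δ₀, Λ' δ₀ → StaticAlongTW W δ₀ ∧ δ₀.Realisable) → Alpha1RowTied W → Rung2b₀Under Λ' 14 RuleD`. -/
theorem alpha1_of_le_lawStaticTied {Λ' : DatumLaw}
    (hle : ∀ (E₀ : AbelianVariety ℂ) (ψ₀ : E₀ ⟶ E₀) (δ₀ : SplitBlockDatum₀ E₀ ψ₀), Λ' E₀ ψ₀ δ₀ → lawStaticTied W E₀ ψ₀ δ₀)
    (h : Alpha1RowTied W) : Rung2b₀Under Λ' 14 LeggedFloor.RuleD :=
  rung2b₀Under_antitone hle h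

/-- in particular under `lawAnd (lawStaticTied W) kniLaw` (the (8σ) conjunction with the tie adjoined, = g1's `lawSigma` up to bracketing). -/
theorem alpha1Row_lawAnd_tied_of_alpha1RowTied (h : Alpha1RowTied W) :
    Rung2b₀Under (lawAnd (lawStaticTied W) kniLaw) 14 LeggedFloor.RuleD :=
  rung2b₀Under_lawAnd_of_left h

/-- and the bare-law conjunction of (8σ). -/
theorem alpha1Row_lawAnd_of_alpha1OfStatic (h : Alpha1OfStatic W) : Rung2b₀Under (lawAnd (StaticAlongTW W) kniLaw) 14 LeggedFloor.RuleD :=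
  rung2b₀Under_lawAnd_of_left (alpha1Row_of_alpha1OfStatic W h)

/-- (8σ) with the tie: `Λ := lawAnd (lawStaticTied W) kniLaw` types and its budget conjunct is kernel as before. -/
example : Prop := Rung2b₀Lci (lawAnd (lawStaticTied W) kniLaw) sigmaH 0

example (δ₀ : SplitBlockDatum₀ E₀ ψ₀) (hΛ : lawAnd (lawStaticTied W) kniLaw E₀ ψ₀ δ₀) (h8 : extBudgetLaw 0 E₀ ψ₀ δ₀) :
    RuleDPlate.BudgetClause sigmaH 0 δ₀.Dsh.shadow :=
  budgetClause_sigmaH_of_lawAnd_kniLaw δ₀ hΛ h8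

/-! ## Carrier bridge to the Literature obstruction class (R19.883 (ii)) — TYPED, NOT PROVED -/

section CarrierBridge

open Literature.AlgebraicGeometry.HodgeTheory

variable {X : SchemeOver ℂ} (hΩ : IsFiniteLocallyFree (cotangentSheaf X)) {E : X.left.Modules} (hE : IsFiniteLocallyFree E)

/-- **`ObstructionCarrierBridge hΩ hE`** — the one-lemma bridge `obstructionMap_eq_kodairaSpencerObstruction` between layer (A)'s carrier and the Literature carrier
of `ob_κ(E) = (id_E ⊗ κ) ∘ At(E)` (Huybrechts–Thomas 2010, Main Theorem): `∀ κ ∈ Ext¹(Ω¹_X, 𝒪_X), obstructionMap hE κ = kodairaSpencerObstruction hΩ hE κ`.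
A `Prop`, to be PROVED (ingredients: comparison `atiyahClass E · (twistCotangent E ≅ twistTangentHom E) = atiyahClass' E` for `E`, `Ω¹` finite locally free; naturality of
`𝓗om(E^∨, –) ≅ E ⊗ –` on `Ext`; `toBidual⁻¹` versus the right unitor).  Nothing asserts it. -/
def ObstructionCarrierBridge : Prop := ∀ κ : DefT1 X, obstructionMap hE κ = kodairaSpencerObstruction hΩ hE κ

variable {hΩ hE}

/-- transport of `UnobstructedAlong` to the Literature carrier, given the bridge. -/
theorem unobstructedAlong_iff_lit (h : ObstructionCarrierBridge hΩ hE) (T : Set (DefT1 X)) :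
    UnobstructedAlong hE T ↔ ∀ κ ∈ T, kodairaSpencerObstruction hΩ hE κ = 0 := by
  simp only [unobstructedAlong_iff, h _]

/-- transport of the law `StaticAlongTW` to the Literature carrier on a datum, given the bridge at `(Ω¹ of the anchor, δ₀.S.X₃)`. -/
theorem staticAlongTW_iff_lit (δ₀ : SplitBlockDatum₀ E₀ ψ₀) (hΩ₀ : IsFiniteLocallyFree (cotangentSheaf (pad4Anchor E₀).X))
    (h : ObstructionCarrierBridge hΩ₀ (Modules.isFiniteLocallyFree_of_isVectorBundle δ₀.isVectorBundle₃)) :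
    StaticAlongTW W E₀ ψ₀ δ₀ ↔
      ∀ κ ∈ (W E₀ ψ₀).carrier, kodairaSpencerObstruction hΩ₀ (Modules.isFiniteLocallyFree_of_isVectorBundle δ₀.isVectorBundle₃) κ = 0 :=
  unobstructedAlong_iff_lit h _

end CarrierBridge

end Summit.HodgeConjecture.HodgeConjecture.Cruxes.BlochSeedDiscOne.StaticAlongTW

end
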